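import Summits.QuantumFields.YangMills.Theses.FradkinShenkerFlow
import Literature.MathematicalPhysics.QuantumLattice.TorusWilsonGibbs
import Summits.QuantumFields.YangMills.Theorems.FradkinShenkerFlowSusceptibilityToPoincareHaarResample
import Summits.QuantumFields.YangMills.Theorems.FradkinShenkerFlowSusceptibilityToPoincareOrbitSliceSplit
import Summits.QuantumFields.YangMills.Theorems.FradkinShenkerFlowSusceptibilityToPoincareOrbitEfronStein
import Literature.Probability.Moments.EfronSteinProofs

/-!
# Kernel variance bounds for stub `stub_localPoincare_smallCylinders` (line `maxcorr-halving`, crux `SusceptibilityToPoincare`)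

Route `FradkinShenkerFlow` of `YangMills`, crux item `stmt-QuantumFields-9441`
(`Summit.QuantumFields.YangMills.Theses.FradkinShenkerFlow.SusceptibilityToPoincare`, FS ⇒ UP).
Helper file (supports the item, closes nothing) for stub C3 `stub_localPoincare_smallCylinders` of
the registered skeleton `Cruxes/SusceptibilityToPoincare/Lines/maxcorr-halving.lean` (per-volume
Poincaré inequality for small cylinders, proved in
`FradkinShenkerFlowSusceptibilityToPoincareLocalPoincareSmallCylinders.lean`): the volume-independent
ingredients of the bound INSIDE ONE GIBBSIAN KERNEL.

## Contents (theorems only, namespace `LocalPoincare`)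

* *Holley–Stroock for tilts of bounded oscillation* (abstract probability): for a probability
  measure `κ` and a tilt `f` of oscillation `≤ c`, the density of `κ.tilted f` lies in
  `[e^{−c}, e^{c}]`, so `∫ ψ d(κ.tilted f) ≤ e^{c} ∫ ψ dκ` for bounded measurable `ψ ≥ 0`
  (`integral_tilted_le_exp_mul_integral`, converse of the landed
  `HaarResample.integral_le_exp_mul_integral_tilted`), and a variance bound
  `Var_κ g ≤ D Σ_i ∫ Ψ_i dκ` transfers to `κ.tilted f` at the cost `e^{2c}`
  (`integral_sub_sq_tilted_le`: the variance is at most the second moment about the `κ`-mean,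
  `integral_sub_sq_eq_variance_add_sq`).
* *Efron–Stein under a tilt* (`integral_sub_sq_tilted_pi_le`): on a finite product `λ^{⊗ι}` the
  tree's Efron–Stein inequality (`Literature.Probability.Moments.EfronSteinInequality_holds`) is the
  input variance bound, with `Ψ_i ζ = ∫ (g ζ − g(update ζ i y))² dλ(y)`.
* *Gluing* (`glueWith_update`, `integral_tilted_map_eq`, `integral_sub_sq_kernel_le`): the
  Gibbsian kernel `(λ^{⊗Λ} ∘ glueWith⁻¹(·, η)).tilted φ` is the push-forward of a tilted product
  measure along the gluing map, updating a coordinate commutes with gluing, hence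
  `∫ (F − κF)² dκ ≤ e^{2c} · ½ Σ_{i ∈ Λ} ∫∫ (F σ − F(σ[i ↦ y]))² dλ(y) dκ(σ)` whenever the tilt
  oscillates by at most `c` over the glued configurations.
* *Torus geometry* (`card_filter_fst_mem_le`, `abs_wilsonAction_sub_le`): a cylinder with all
  sides `≤ m` carries at most `d m^d` links, and two configurations agreeing off a link set `Λ`
  have Wilson actions differing by at most `2 (#Λ (d+1)) #{planes} (N + sup |Re tr ρ|)`
  (shadow/bulk split of the action, `bulkAction_congr`, `abs_shadowAction_le`).
-/

noncomputable section

open MeasureTheory ProbabilityTheory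
open Literature.MathematicalPhysics.QuantumFieldTheory
open Literature.Probability.LatticeModels

namespace Summit.QuantumFields.YangMills.Theorems.SusceptibilityToPoincare

namespace LocalPoincare

/-! ### Abstract probability: Holley–Stroock comparison for tilts of bounded oscillation -/

section Abstract

variable {K : Type*} [MeasurableSpace K]

/-- **Resampling from the tilted measure is dominated by resampling from `κ`**: for a probability
measure `κ`, a tilt `f` with `e^{f}` integrable and oscillation at most `c`, and a bounded
measurable `ψ ≥ 0`, `∫ ψ d(κ.tilted f) ≤ e^{c} ∫ ψ dκ` (the density of `κ.tilted f` with respect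
to `κ` is at most `e^{c}`). [folklore] -/
theorem integral_tilted_le_exp_mul_integral {κ : Measure K} [IsProbabilityMeasure κ]
    {f : K → ℝ} {c : ℝ} (hfi : Integrable (fun h => Real.exp (f h)) κ)
    (hosc : ∀ h h', f h' ≤ f h + c) {ψ : K → ℝ} (hψ : Measurable ψ) (hψ0 : ∀ h, 0 ≤ ψ h)
    {B : ℝ} (hψB : ∀ h, ψ h ≤ B) :
    ∫ h, ψ h ∂(κ.tilted f) ≤ Real.exp c * ∫ h, ψ h ∂κ := by
  rw [integral_tilted, ← integral_const_mul]
  have hdens' : ∀ h, Real.exp (f h) / ∫ h', Real.exp (f h') ∂κ ≤ Real.exp c :=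
    HaarResample.exp_div_integral_le_exp hfi hosc
  have hψi : Integrable ψ κ := Integrable.of_bound hψ.aestronglyMeasurable B
    (ae_of_all _ fun h => by rw [Real.norm_eq_abs, abs_of_nonneg (hψ0 h)]; exact hψB h)
  refine integral_mono_of_nonneg (ae_of_all _ fun h => ?_) (hψi.const_mul _)
    (ae_of_all _ fun h => ?_)
  · exact smul_nonneg (div_nonneg (Real.exp_pos _).le
      (integral_nonneg fun _ => (Real.exp_pos _).le)) (hψ0 h)
  · simp only [smul_eq_mul]
    exact mul_le_mul_of_nonneg_right (hdens' h) (hψ0 h)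

/-- **Holley–Stroock transfer of a variance bound through a tilt of bounded oscillation.** Let
`κ` be a probability measure, `f` a measurable tilt with `e^{f}` integrable and oscillation at
most `c`, `g` measurable with `|g| ≤ M`, and suppose `Var_κ(g) ≤ D Σ_{i ∈ s} ∫ Ψ_i dκ` for bounded
measurable `Ψ_i ≥ 0` and `D ≥ 0`. Then the variance of `g` under `κ.tilted f` obeys the same bound
with the `Ψ_i` integrated against `κ.tilted f`, at the cost `e^{2c}`:
centring at the `κ`-mean can only increase the tilted variance, the tilted density lies in
`[e^{-c}, e^{c}]`. [folklore] -/
theorem integral_sub_sq_tilted_le {κ : Measure K} [IsProbabilityMeasure κ]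
    {f : K → ℝ} {c : ℝ} (hf : Measurable f) (hfi : Integrable (fun h => Real.exp (f h)) κ)
    (hosc : ∀ h h', f h' ≤ f h + c) {g : K → ℝ} (hg : Measurable g) {M : ℝ}
    (hM : ∀ h, |g h| ≤ M) {ι : Type*} (s : Finset ι) {Ψ : ι → K → ℝ}
    (hΨ : ∀ i, Measurable (Ψ i)) (hΨ0 : ∀ i h, 0 ≤ Ψ i h) {B : ℝ} (hΨB : ∀ i h, Ψ i h ≤ B)
    {D : ℝ} (hD : 0 ≤ D) (hvar : variance g κ ≤ D * ∑ i ∈ s, ∫ h, Ψ i h ∂κ) :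
    ∫ h, (g h - ∫ h', g h' ∂(κ.tilted f)) ^ 2 ∂(κ.tilted f) ≤
      Real.exp c * Real.exp c * D * ∑ i ∈ s, ∫ h, Ψ i h ∂(κ.tilted f) := by
  haveI : IsProbabilityMeasure (κ.tilted f) := isProbabilityMeasure_tilted hfi
  set c₀ : ℝ := ∫ h, g h ∂κ with hc₀
  -- centring at the tilted mean is optimal
  have h1 : ∫ h, (g h - ∫ h', g h' ∂(κ.tilted f)) ^ 2 ∂(κ.tilted f) ≤
      ∫ h, (g h - c₀) ^ 2 ∂(κ.tilted f) := by
    rw [integral_sub_sq_eq_variance_add_sq (π := κ.tilted f) hg hM,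
      integral_sub_sq_eq_variance_add_sq (π := κ.tilted f) hg hM, sub_self]
    nlinarith [sq_nonneg ((∫ h, g h ∂(κ.tilted f)) - c₀)]
  -- the centred square is bounded and measurable
  have hc₀M : |c₀| ≤ M := by
    have := norm_integral_le_of_norm_le_const (μ := κ) (C := M) (f := g)
      (ae_of_all _ fun h => by rw [Real.norm_eq_abs]; exact hM h)
    simpa only [Real.norm_eq_abs, probReal_univ, mul_one] using this
  have hsqm : Measurable fun h => (g h - c₀) ^ 2 := (hg.sub_const _).pow_const 2
  have hsqB : ∀ h, (g h - c₀) ^ 2 ≤ (2 * M) ^ 2 := fun h => by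
    have h2 := OrbitES.norm_sq_sub_le (hM h) hc₀M
    rwa [norm_pow, Real.norm_eq_abs, sq_abs] at h2
  -- tilted → untilted for the centred square, untilted → tilted for the `Ψ_i`
  have h2 : ∫ h, (g h - c₀) ^ 2 ∂(κ.tilted f) ≤ Real.exp c * ∫ h, (g h - c₀) ^ 2 ∂κ :=
    integral_tilted_le_exp_mul_integral hfi hosc hsqm (fun h => sq_nonneg _) hsqB
  have h3 : ∫ h, (g h - c₀) ^ 2 ∂κ = variance g κ := by
    rw [integral_sub_sq_eq_variance_add_sq hg hM, hc₀, sub_self]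
    ring
  have h4 : ∀ i ∈ s, ∫ h, Ψ i h ∂κ ≤ Real.exp c * ∫ h, Ψ i h ∂(κ.tilted f) := fun i _ =>
    HaarResample.integral_le_exp_mul_integral_tilted hf hfi hosc (hΨ i) (hΨ0 i) (hΨB i)
  calc ∫ h, (g h - ∫ h', g h' ∂(κ.tilted f)) ^ 2 ∂(κ.tilted f)
      ≤ ∫ h, (g h - c₀) ^ 2 ∂(κ.tilted f) := h1
    _ ≤ Real.exp c * ∫ h, (g h - c₀) ^ 2 ∂κ := h2
    _ = Real.exp c * variance g κ := by rw [h3]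
    _ ≤ Real.exp c * (D * ∑ i ∈ s, ∫ h, Ψ i h ∂κ) :=
        mul_le_mul_of_nonneg_left hvar (Real.exp_pos _).le
    _ ≤ Real.exp c * (D * ∑ i ∈ s, (Real.exp c * ∫ h, Ψ i h ∂(κ.tilted f))) :=
        mul_le_mul_of_nonneg_left (mul_le_mul_of_nonneg_left (Finset.sum_le_sum h4) hD)
          (Real.exp_pos _).le
    _ = Real.exp c * Real.exp c * D * ∑ i ∈ s, ∫ h, Ψ i h ∂(κ.tilted f) := by
        rw [← Finset.mul_sum]; ring

/-- **Integrals against a tilted push-forward**: for measurable `e : A → X`, tilt `φ` and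
integrand `ψ`, `∫ ψ d((μ ∘ e⁻¹).tilted φ) = ∫ (ψ ∘ e) d(μ.tilted (φ ∘ e))`. [folklore] -/
theorem integral_tilted_map_eq {A X : Type*} [MeasurableSpace A] [MeasurableSpace X]
    {μ : Measure A} {e : A → X} (he : Measurable e) {φ : X → ℝ} (hφ : Measurable φ)
    {ψ : X → ℝ} (hψ : Measurable ψ) :
    ∫ σ, ψ σ ∂((μ.map e).tilted φ) = ∫ ζ, ψ (e ζ) ∂(μ.tilted fun ζ => φ (e ζ)) := by
  have hZ : ∫ σ, Real.exp (φ σ) ∂(μ.map e) = ∫ ζ, Real.exp (φ (e ζ)) ∂μ :=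
    integral_map he.aemeasurable hφ.exp.aestronglyMeasurable
  rw [integral_tilted, integral_tilted, hZ, integral_map he.aemeasurable]
  exact ((hφ.exp.div_const _).smul hψ).aestronglyMeasurable

end Abstract

/-! ### Product spaces: Efron–Stein under a tilt, and gluing -/

section Product

variable {V S : Type*} [MeasurableSpace S]

omit [MeasurableSpace S] in
/-- Updating one coordinate inside `Λ` commutes with gluing:
`(update ζ i y) η_{Λᶜ} = update (ζ η_{Λᶜ}) i y`. [folklore] -/
theorem glueWith_update [DecidableEq V] (Λ : Finset V) (ζ : Λ → S) (η : V → S) (i : Λ)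
    (y : S) : glueWith Λ (Function.update ζ i y) η = Function.update (glueWith Λ ζ η) (↑i) y := by
  funext j
  by_cases hj : j = (i : V)
  · subst hj
    rw [Function.update_self, glueWith_apply_mem _ _ _ i.2]
    simp
  · rw [Function.update_of_ne hj]
    by_cases hjΛ : j ∈ Λ
    · rw [glueWith_apply_mem _ _ _ hjΛ, glueWith_apply_mem _ _ _ hjΛ, Function.update_of_ne]
      exact fun h => hj (congrArg Subtype.val h)
    · rw [glueWith_apply_not_mem _ _ _ hjΛ, glueWith_apply_not_mem _ _ _ hjΛ]

/-- **Efron–Stein under a tilt of bounded oscillation** on a finite product of copies of a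
probability space `(S, λ)`: for a measurable bounded tilt `f` of oscillation at most `c` and a
measurable `g` with `|g| ≤ M`,
`Var_{π.tilted f}(g) ≤ e^{2c} · ½ Σ_i ∫∫ (g ζ − g(update ζ i y))² dλ(y) d(π.tilted f)(ζ)`,
`π = λ^{⊗ι}` — the tree's Efron–Stein inequality (`EfronSteinInequality_holds`) transferred through
the tilt (`integral_sub_sq_tilted_le`). [folklore] -/
theorem integral_sub_sq_tilted_pi_le {ι : Type*} [Fintype ι] [DecidableEq ι] (lam : Measure S)
    [IsProbabilityMeasure lam] {f : (ι → S) → ℝ} {c : ℝ} (hf : Measurable f)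
    (hfb : ∃ a, ∀ ζ, |f ζ| ≤ a) (hosc : ∀ ζ ζ', f ζ' ≤ f ζ + c) {g : (ι → S) → ℝ}
    (hg : Measurable g) {M : ℝ} (hM : ∀ ζ, |g ζ| ≤ M) :
    ∫ ζ, (g ζ - ∫ ζ', g ζ' ∂((Measure.pi fun _ : ι => lam).tilted f)) ^ 2
        ∂((Measure.pi fun _ : ι => lam).tilted f) ≤
      Real.exp c * Real.exp c * (1 / 2 : ℝ) * ∑ i, ∫ ζ, ∫ y, (g ζ - g (Function.update ζ i y)) ^ 2
        ∂lam ∂((Measure.pi fun _ : ι => lam).tilted f) := by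
  set κ : Measure (ι → S) := Measure.pi fun _ : ι => lam with hκ
  obtain ⟨a, ha⟩ := hfb
  have hfi : Integrable (fun ζ => Real.exp (f ζ)) κ := by
    refine Integrable.of_bound hf.exp.aestronglyMeasurable (Real.exp a) (ae_of_all _ fun ζ => ?_)
    rw [Real.norm_eq_abs, Real.abs_exp, Real.exp_le_exp]
    exact (le_abs_self _).trans (ha ζ)
  have hmem : MemLp g 2 κ := MemLp.of_bound hg.aestronglyMeasurable M
    (ae_of_all _ fun ζ => by simpa only [Real.norm_eq_abs] using hM ζ)
  have hES := Literature.Probability.Moments.EfronSteinInequality_holds ι (fun _ => S)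
    (fun _ => lam) g hg hmem
  -- the resampling costs `Ψ_i ζ = ∫ (g ζ − g(update ζ i y))² dλ(y)`: measurable, `0 ≤ Ψ_i ≤ (2M)²`
  have hDm : ∀ i, Measurable fun q : (ι → S) × S => (g q.1 - g (Function.update q.1 i q.2)) ^ 2 :=
    fun i => ((hg.comp measurable_fst).sub (hg.comp measurable_update')).pow_const 2
  have hΨm : ∀ i, Measurable fun ζ => ∫ y, (g ζ - g (Function.update ζ i y)) ^ 2 ∂lam :=
    fun i => ((hDm i).stronglyMeasurable.integral_prod_right' (ν := lam)).measurable
  have hΨB : ∀ i ζ, ∫ y, (g ζ - g (Function.update ζ i y)) ^ 2 ∂lam ≤ (2 * M) ^ 2 := fun i ζ => by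
    have := norm_integral_le_of_norm_le_const (μ := lam) (C := (2 * M) ^ 2)
      (f := fun y => (g ζ - g (Function.update ζ i y)) ^ 2)
      (ae_of_all _ fun y => OrbitES.norm_sq_sub_le (hM _) (hM _))
    rw [probReal_univ, mul_one, Real.norm_eq_abs, abs_of_nonneg (integral_nonneg fun _ => sq_nonneg _)] at this
    exact this
  exact integral_sub_sq_tilted_le hf hfi hosc hg hM Finset.univ hΨm
    (fun i ζ => integral_nonneg fun _ => sq_nonneg _) hΨB (by norm_num : (0 : ℝ) ≤ 1 / 2) hES

/-- **Local Poincaré inequality inside one Gibbsian kernel.** For a probability measure `λ` on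
`S`, a finite volume `Λ`, a boundary condition `η`, a bounded measurable tilt `φ` whose oscillation
over the glued configurations `ζ η_{Λᶜ}` is at most `c`, and a measurable `F` with `|F| ≤ M`, the
kernel `κ = (λ^{⊗Λ} ∘ glueWith⁻¹(·, η)).tilted φ` satisfies
`∫ (F − κF)² dκ ≤ e^{2c} · ½ Σ_{i ∈ Λ} ∫∫ (F σ − F(update σ i y))² dλ(y) dκ(σ)` — Holley–Stroock
against glued product measure and Efron–Stein, transported along the gluing map. [folklore] -/
theorem integral_sub_sq_kernel_le [DecidableEq V] (lam : Measure S) [IsProbabilityMeasure lam]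
    (Λ : Finset V) (η : V → S) {φ : (V → S) → ℝ} (hφ : Measurable φ)
    (hφb : ∃ a, ∀ σ, |φ σ| ≤ a) {c : ℝ}
    (hosc : ∀ ζ ζ' : Λ → S, φ (glueWith Λ ζ' η) ≤ φ (glueWith Λ ζ η) + c)
    {F : (V → S) → ℝ} (hF : Measurable F) {M : ℝ} (hM : ∀ σ, |F σ| ≤ M) :
    ∫ σ, (F σ - ∫ σ', F σ'
        ∂(((Measure.pi fun _ : Λ => lam).map (glueWith Λ · η)).tilted φ)) ^ 2
        ∂(((Measure.pi fun _ : Λ => lam).map (glueWith Λ · η)).tilted φ) ≤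
      Real.exp c * Real.exp c * (1 / 2 : ℝ) * ∑ i : Λ, ∫ σ, ∫ y,
        (F σ - F (Function.update σ (↑i) y)) ^ 2 ∂lam
        ∂(((Measure.pi fun _ : Λ => lam).map (glueWith Λ · η)).tilted φ) := by
  have hgl : Measurable fun ζ : Λ → S => glueWith Λ ζ η := measurable_glueWith Λ η
  obtain ⟨a, ha⟩ := hφb
  -- transport every integral to the product space `Λ → S`
  have hmean : ∫ σ', F σ' ∂(((Measure.pi fun _ : Λ => lam).map (glueWith Λ · η)).tilted φ) =
      ∫ ζ, F (glueWith Λ ζ η) ∂((Measure.pi fun _ : Λ => lam).tilted fun ζ => φ (glueWith Λ ζ η)) :=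
    integral_tilted_map_eq hgl hφ hF
  have hDm : ∀ i : Λ, Measurable fun q : (V → S) × S =>
      (F q.1 - F (Function.update q.1 (↑i) q.2)) ^ 2 :=
    fun i => ((hF.comp measurable_fst).sub (hF.comp measurable_update')).pow_const 2
  have hΨm : ∀ i : Λ, Measurable fun σ => ∫ y, (F σ - F (Function.update σ (↑i) y)) ^ 2 ∂lam :=
    fun i => ((hDm i).stronglyMeasurable.integral_prod_right' (ν := lam)).measurable
  rw [hmean, integral_tilted_map_eq hgl hφ ((hF.sub_const _).pow_const 2)]
  have hrhs : ∀ i : Λ, ∫ σ, ∫ y, (F σ - F (Function.update σ (↑i) y)) ^ 2 ∂lam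
      ∂(((Measure.pi fun _ : Λ => lam).map (glueWith Λ · η)).tilted φ) =
      ∫ ζ, ∫ y, (F (glueWith Λ ζ η) - F (glueWith Λ (Function.update ζ i y) η)) ^ 2 ∂lam
        ∂((Measure.pi fun _ : Λ => lam).tilted fun ζ => φ (glueWith Λ ζ η)) := fun i => by
    rw [integral_tilted_map_eq hgl hφ (hΨm i)]
    simp only [glueWith_update]
  simp only [hrhs]
  exact integral_sub_sq_tilted_pi_le lam (hφ.comp hgl) ⟨a, fun ζ => ha _⟩ hosc (hF.comp hgl)
    (fun ζ => hM _)

end Product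

/-! ### The torus: counting the links of a small cylinder, oscillation of the Wilson action -/

section Lattice

/-- **A cylinder with all sides `≤ m` carries at most `d · m^d` links**: the links based in
`Q = {x | ∀ ν, (x ν − a ν).val < n ν}` with `n ν ≤ m` inject into `(Fin d → range m) × Fin d` by
`ℓ ↦ ((ℓ.1 − a).val, ℓ.2)`. [folklore] -/
theorem card_filter_fst_mem_le {d L : ℕ} [NeZero L] (a : Fin d → ZMod L) (n : Fin d → ℕ)
    {m : ℕ} (hnm : ∀ ν, n ν ≤ m) (Q : Set (Site d L))
    (hQ : Q = {x | ∀ ν, (x ν - a ν).val < n ν}) [DecidablePred fun ℓ : Edge d L => ℓ.1 ∈ Q] :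
    (Finset.univ.filter fun ℓ : Edge d L => ℓ.1 ∈ Q).card ≤ d * m ^ d := by
  have hmaps : Set.MapsTo (fun ℓ : Edge d L => (fun ν => (ℓ.1 ν - a ν).val, ℓ.2))
      ↑(Finset.univ.filter fun ℓ : Edge d L => ℓ.1 ∈ Q)
      ↑((Fintype.piFinset fun _ : Fin d => Finset.range m) ×ˢ (Finset.univ : Finset (Fin d))) := by
    intro ℓ hℓ
    have hℓQ : ℓ.1 ∈ Q := (Finset.mem_filter.1 (Finset.mem_coe.1 hℓ)).2
    rw [hQ] at hℓQ
    simp only [Finset.coe_product, Finset.coe_univ, Set.mem_prod, Set.mem_univ, and_true,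
      Finset.mem_coe, Fintype.mem_piFinset, Finset.mem_range]
    exact fun ν => (hℓQ ν).trans_le (hnm ν)
  have hinj : Set.InjOn (fun ℓ : Edge d L => (fun ν => (ℓ.1 ν - a ν).val, ℓ.2))
      ↑(Finset.univ.filter fun ℓ : Edge d L => ℓ.1 ∈ Q) := by
    intro ℓ _ ℓ' _ h
    simp only [Prod.mk.injEq] at h
    obtain ⟨h1, h2⟩ := h
    refine Prod.ext (funext fun ν => ?_) h2
    have h3 : ℓ.1 ν - a ν = ℓ'.1 ν - a ν := ZMod.val_injective L (congr_fun h1 ν)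
    exact sub_left_inj.1 h3
  calc (Finset.univ.filter fun ℓ : Edge d L => ℓ.1 ∈ Q).card
      ≤ ((Fintype.piFinset fun _ : Fin d => Finset.range m) ×ˢ
          (Finset.univ : Finset (Fin d))).card :=
        Finset.card_le_card_of_injOn _ hmaps hinj
    _ = d * m ^ d := by
        rw [Finset.card_product, Fintype.card_piFinset, Finset.prod_const, Finset.card_range,
          Finset.card_univ, Fintype.card_fin]
        ring

/-- **Oscillation of the Wilson action under a change of the links in `Λ`, uniformly in the
volume**: two configurations agreeing off `Λ` have the same bulk action off the shadow of `Λ`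
(`bulkAction_congr`), and the shadow part is at most `(#Λ (d+1)) · #{planes} · (N + M)`
(`abs_shadowAction_le`, `card_edgeShadow_le`). [folklore] -/
theorem abs_wilsonAction_sub_le {d L N : ℕ} [NeZero L] {G : Type*} [Group G]
    (ρ : G →* Matrix (Fin N) (Fin N) ℂ) {M : ℝ} (hM : ∀ g, |(ρ g).trace.re| ≤ M)
    (Λ : Finset (Edge d L)) {U V : GaugeConfig d L G} (hUV : ∀ e, e ∉ Λ → U e = V e) :
    |wilsonAction ρ U - wilsonAction ρ V| ≤
      2 * (((Λ.card * (d + 1) * Fintype.card {q : Fin d × Fin d // q.1 < q.2} : ℕ) : ℝ) *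
        ((N : ℝ) + M)) := by
  rw [wilsonAction_eq_shadowAction_add_bulkAction ρ (edgeShadow Λ) U,
    wilsonAction_eq_shadowAction_add_bulkAction ρ (edgeShadow Λ) V, bulkAction_congr ρ hUV,
    add_sub_add_right_eq_sub]
  have hM0 : 0 ≤ M := (abs_nonneg _).trans (hM 1)
  have hNM : 0 ≤ (N : ℝ) + M := by positivity
  have hsh : ∀ W : GaugeConfig d L G, |shadowAction ρ (edgeShadow Λ) W| ≤
      ((Λ.card * (d + 1) * Fintype.card {q : Fin d × Fin d // q.1 < q.2} : ℕ) : ℝ) *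
        ((N : ℝ) + M) :=
    fun W => (abs_shadowAction_le ρ hM _ W).trans (mul_le_mul_of_nonneg_right
      (Nat.cast_le.2 (Nat.mul_le_mul_right _ (card_edgeShadow_le Λ))) hNM)
  calc |shadowAction ρ (edgeShadow Λ) U - shadowAction ρ (edgeShadow Λ) V|
      ≤ |shadowAction ρ (edgeShadow Λ) U| + |shadowAction ρ (edgeShadow Λ) V| := abs_sub _ _
    _ ≤ _ := add_le_add (hsh U) (hsh V)
    _ = _ := by ring

end Lattice

end LocalPoincare

/-! ### The registered sub-goal -/

/-- `stub_localPoincare_kernelVariance` — **local Poincaré inequality inside one Gibbsian kernel**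
(registered sub-goal of stub C3 `stub_localPoincare_smallCylinders`, line `maxcorr-halving`):
for a probability measure `λ` on the spin space, a finite volume `Λ`, a boundary condition `η`, a
bounded measurable tilt `φ` oscillating by at most `c` over the glued configurations `ζ η_{Λᶜ}`,
and a measurable `F` with `|F| ≤ M`, the Gibbsian kernel `κ = (λ^{⊗Λ} ∘ glueWith⁻¹(·, η)).tilted φ`
satisfies `∫ (F − κF)² dκ ≤ e^{2c} · ½ Σ_{i ∈ Λ} ∫∫ (F σ − F(σ[i ↦ y]))² dλ(y) dκ(σ)`
(Holley–Stroock + Efron–Stein, `integral_sub_sq_kernel_le`). [folklore] -/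
theorem stub_localPoincare_kernelVariance :
    ∀ (V : Type) [DecidableEq V] (X : Type) [MeasurableSpace X] (lam : Measure X)
      [IsProbabilityMeasure lam] (Λ : Finset V) (η : V → X) (φ : (V → X) → ℝ), Measurable φ →
      (∃ A : ℝ, ∀ σ, |φ σ| ≤ A) → ∀ (c : ℝ), (∀ ζ ζ' : Λ → X,
        φ (Literature.Probability.LatticeModels.glueWith Λ ζ' η) ≤
          φ (Literature.Probability.LatticeModels.glueWith Λ ζ η) + c) →
      ∀ (F : (V → X) → ℝ), Measurable F → ∀ (M : ℝ), (∀ σ, |F σ| ≤ M) →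
      ∀ (κ : Measure (V → X)), κ = ((Measure.pi fun _ : Λ => lam).map
          (fun ζ => Literature.Probability.LatticeModels.glueWith Λ ζ η)).tilted φ →
      ∫ σ, (F σ - ∫ σ', F σ' ∂κ) ^ 2 ∂κ ≤ Real.exp c * Real.exp c * (1 / 2 : ℝ) *
        ∑ i : Λ, ∫ σ, ∫ y, (F σ - F (Function.update σ (↑i) y)) ^ 2 ∂lam ∂κ := by
  intro V _ X _ lam _ Λ η φ hφ hφb c hosc F hF M hM κ hκ
  subst hκ
  exact LocalPoincare.integral_sub_sq_kernel_le lam Λ η hφ hφb hosc hF hM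

end Summit.QuantumFields.YangMills.Theorems.SusceptibilityToPoincare

end
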